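import Mathlib
import HarnessLib
import Summits.ValiantsHypothesis.ValiantsHypothesis.Theses.MonotoneRestoration
import Literature.Computability.AlgebraicComplexity.ArithCircuit
import Literature.Computability.AlgebraicComplexity.ArithCircuitProofs
import Literature.Computability.AlgebraicComplexity.MonotoneStructure
import Literature.Computability.AlgebraicComplexity.PermanentIrreducible
import Literature.ModelTheory.FiniteModelTheory.CkEquiv
import Summits.ValiantsHypothesis.ValiantsHypothesis.Theorems.MonotoneRestorationMonotoneRestorationQPCosetCount
import Summits.ValiantsHypothesis.ValiantsHypothesis.Theorems.MonotoneRestorationMonotoneRestorationQPSymmetricLB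
import Summits.ValiantsHypothesis.ValiantsHypothesis.Theorems.MonotoneRestorationMonotoneRestorationQPSupportSymmetrisation
import Summits.ValiantsHypothesis.ValiantsHypothesis.Theorems.MonotoneRestorationMonotoneRestorationQPSparseRegime
import Summits.ValiantsHypothesis.ValiantsHypothesis.Theorems.MonotoneRestorationMonotoneRestorationQPBeta
import Literature.Computability.AlgebraicComplexity.SymmetricArithCircuit
import Literature.Computability.AlgebraicComplexity.DawarWilsenach2025Proofs
import Literature.GroupTheory.PermutationGroups.SmallIndexSubgroups
import Summits.ValiantsHypothesis.ValiantsHypothesis.Theorems.MonotoneRestorationQP.Negative.LoadBearing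
import Summits.ValiantsHypothesis.ValiantsHypothesis.Theorems.MonotoneRestorationMonotoneRestorationQPPermSupportCount

/-! TTRL-lite variant V19128 of stmt-ValiantsHypothesis-15886 -/

-- `Summit.ValiantsHypothesis.ValiantsHypothesis.…` is the tree's mandated single-conjunct layout
-- (Sub = Summit), so the duplicated namespace component is intended.
set_option linter.dupNamespace false

namespace Summit.ValiantsHypothesis.ValiantsHypothesis.Theorems

open Summit.ValiantsHypothesis.ValiantsHypothesis.Theses.MonotoneRestoration
open Literature.Computability.AlgebraicComplexity

/-- **TTRL-lite variant V19128** of `stub_esymmRowSums_structure`: for a set of rows `t`, every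
monomial `m` in the support of the product of row sums `∏_{i ∈ t} R_i`, `R_i = Σ_j x_{i,j}`
(over `ℝ≥0`), has row degree at most `1` in each row of `t` and row degree `0` outside `t`,
i.e. `rowDegrees m ≤ 𝟙_t`. Proof by induction on `t`: a monomial of `R_a * ∏_{i∈t} R_i` is
`single (a, j) 1 + m₂` with `m₂` a monomial of `∏_{i∈t} R_i` (`support_mul`, `support_sum`,
`support_X`), and `rowDegrees` is additive. [folklore] -/
theorem stub_esymmRowSums_structure_var19128 :
    ∀ (n : ℕ) (t : Finset (Fin n)), ∀ m ∈ (∏ i ∈ t, ∑ j : Fin n,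
      (MvPolynomial.X (i, j) : MvPolynomial (Fin n × Fin n) NNReal)).support,
      ∀ i : Fin n, rowDegrees m i ≤ if i ∈ t then 1 else 0 := by
  classical
  intro n t
  induction t using Finset.induction_on with
  | empty =>
    intro m hm i
    rw [Finset.prod_empty, MvPolynomial.support_one, Finset.mem_singleton] at hm
    simp [hm]
  | insert a t ha ih =>
    intro m hm i
    rw [Finset.prod_insert ha] at hm
    obtain ⟨m₁, hm₁, m₂, hm₂, rfl⟩ := Finset.mem_add.1 (MvPolynomial.support_mul _ _ hm)
    obtain ⟨j, -, hj⟩ := Finset.mem_biUnion.1 (MvPolynomial.support_sum hm₁)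
    rw [MvPolynomial.support_X, Finset.mem_singleton] at hj
    subst hj
    have h₂ := ih m₂ hm₂ i
    rw [rowDegrees_add, rowDegrees_single, Finsupp.add_apply]
    by_cases hi : i = a
    · subst hi
      rw [if_neg ha] at h₂
      rw [Finsupp.single_eq_same, if_pos (Finset.mem_insert_self _ _)]
      omega
    · rw [Finsupp.single_eq_of_ne hi, zero_add]
      simpa [Finset.mem_insert, hi] using h₂

end Summit.ValiantsHypothesis.ValiantsHypothesis.Theorems
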